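import Mathlib
import Literature.NumberTheory.DiophantineGeometry.Mason1984.ProjectiveMasonStothers
import HarnessLib

/-!
# Mason–Stothers bounds the surplus of every polynomial identity

Solo seat `solo-ABC-blind` (ideation tier, summit-directed), session 6.

For an identity `a + b = c` in `ℤ[X]` as in `coveringData_of_forms` with factorisation
`a b c = d · X^α (X − 1)^γ · ∏ᵢ Pᵢ^{eᵢ}`, the projective Mason–Stothers inequality
(`Literature.NumberTheory.DiophantineGeometry.Mason1984.mason_projective`, Mason 1984 [Mason1984],
Stothers 1981 [Stothers1981]) gives `n ≤ s + 1` for the surplus `s = Σᵢ deg Pᵢ`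
(`surplus_ge_of_identity`): the hypothesis `n ≤ s + 1` of the seat's transfer theorem
`forms_no_gain` (Theorems/SoloBlindFormsBridge.lean) holds for every identity and every
factorisation.  This file depends only on Mathlib and the Literature reproduction of Mason–Stothers.
-/

noncomputable section

open Polynomial Finset UniqueFactorizationMonoid
open Literature.NumberTheory.DiophantineGeometry

namespace Summit.ABC.ABC.Theorems

section radical

variable {R : Type*} [CommMonoidWithZero R] [NormalizationMonoid R] [UniqueFactorizationMonoid R]

/-- `rad(y^k) ∣ rad(y)` in any unique factorisation monoid. [folklore] -/
theorem radical_pow_dvd_radical' (y : R) (k : ℕ) : radical (y ^ k) ∣ radical y := by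
  rcases Nat.eq_zero_or_pos k with rfl | hk
  · simp
  · rw [radical_pow y hk.ne']

/-- `rad(∏ fᵢ) ∣ ∏ rad(fᵢ)` in any unique factorisation monoid. [folklore] -/
theorem radical_prod_dvd' {ι : Type*} (s : Finset ι) (f : ι → R) :
    radical (∏ i ∈ s, f i) ∣ ∏ i ∈ s, radical (f i) := by
  classical
  induction s using Finset.induction_on with
  | empty => simp
  | insert i s hi ih =>
    rw [Finset.prod_insert hi, Finset.prod_insert hi]
    exact radical_mul_dvd.trans (mul_dvd_mul_left _ ih)

end radical

/-- **Mason–Stothers bounds the surplus.**  For an identity `a + b = c` in `ℤ[X]` with `deg c = n ≥ 1`,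
`deg a ≤ n`, `a b ≠ 0`, `a, c` coprime over `ℚ` and `a b c = d X^α (X − 1)^γ ∏ Pᵢ^{eᵢ}` (`eᵢ ≥ 1`):
`n ≤ Σ deg Pᵢ + 1`. [cite: Mason1984, Ch. 1 Lemma 2] -/
theorem surplus_ge_of_identity {a b c : ℤ[X]} {n : ℕ} (hn : 1 ≤ n) (hsum : a + b = c)
    (hc : c.natDegree = n) (ha : a.natDegree ≤ n) (ha0 : a ≠ 0) (hb0 : b ≠ 0)
    (hcop : IsCoprime (a.map (Int.castRingHom ℚ)) (c.map (Int.castRingHom ℚ)))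
    {m : ℕ} {d : ℤ} {α γ : ℕ} {P : Fin m → ℤ[X]} {e : Fin m → ℕ} (he : ∀ i, 0 < e i)
    (hfac : a * b * c = C d * X ^ α * (X - 1) ^ γ * ∏ i, P i ^ e i) :
    n ≤ (∑ i, (P i).natDegree) + 1 := by
  classical
  set f := Int.castRingHom ℚ with hf
  have hinj : Function.Injective f := Int.cast_injective
  have hc0 : c ≠ 0 := by rintro rfl; simp at hc; omega
  have habc0 : a * b * c ≠ 0 := mul_ne_zero (mul_ne_zero ha0 hb0) hc0
  have hb : b.natDegree ≤ n := by
    have : b = c - a := by rw [← hsum]; ring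
    rw [this]; exact (natDegree_sub_le _ _).trans (max_le hc.le ha)
  have hd0 : d ≠ 0 := by
    rintro rfl; rw [C_0, zero_mul, zero_mul, zero_mul] at hfac; exact habc0 hfac
  have hP0 : ∀ i, P i ≠ 0 := by
    intro i hi; apply habc0; rw [hfac]
    rw [Finset.prod_eq_zero (Finset.mem_univ i) (by rw [hi, zero_pow (he i).ne'])]; simp
  -- the mapped triple `A + B + (-C) = 0` over `ℚ`
  set A := a.map f with hA
  set B := b.map f with hB
  set Cq := c.map f with hCq
  have hA0 : A ≠ 0 := (Polynomial.map_ne_zero_iff hinj).mpr ha0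
  have hB0 : B ≠ 0 := (Polynomial.map_ne_zero_iff hinj).mpr hb0
  have hC0 : -Cq ≠ 0 := neg_ne_zero.mpr ((Polynomial.map_ne_zero_iff hinj).mpr hc0)
  have hsum' : A + B + -Cq = 0 := by rw [hA, hB, hCq, ← Polynomial.map_add, hsum]; ring
  have hAB : IsCoprime A B := by
    have hB' : B = Cq + A * (-1) := by
      rw [hA, hB, hCq, ← hsum, Polynomial.map_add]; ring
    rw [hB']; exact hcop.add_mul_left_right (-1)
  have hdA : A.natDegree ≤ n := by rw [hA, natDegree_map_eq_of_injective hinj]; exact ha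
  have hdB : B.natDegree ≤ n := by rw [hB, natDegree_map_eq_of_injective hinj]; exact hb
  have hdC : (-Cq).natDegree = n := by rw [natDegree_neg, hCq, natDegree_map_eq_of_injective hinj, hc]
  have hmax : max (max A.natDegree B.natDegree) (-Cq).natDegree = n := by
    rw [hdC]; exact max_eq_right (max_le hdA hdB)
  have hM := Mason1984.mason_projective hA0 hB0 hC0 hAB hsum' (by rw [hmax]; exact hn)
  rw [hmax] at hM
  -- degree of the radical
  have hX1deg : (X - 1 : ℚ[X]).natDegree = 1 := by
    rw [show (X - 1 : ℚ[X]) = X - C 1 by rw [C_1]]; exact natDegree_X_sub_C 1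
  have hX1 : (X - 1 : ℚ[X]) ≠ 0 := by
    intro h; rw [h] at hX1deg; simp at hX1deg
  have hprod : A * B * -Cq = C (-(d : ℚ)) * X ^ α * (X - 1) ^ γ * ∏ i, (P i).map f ^ e i := by
    have : A * B * -Cq = -((a * b * c).map f) := by
      rw [Polynomial.map_mul, Polynomial.map_mul, ← hA, ← hB, ← hCq]; ring
    rw [this, hfac]
    simp only [Polynomial.map_mul, Polynomial.map_pow, Polynomial.map_prod, Polynomial.map_C,
      Polynomial.map_X, Polynomial.map_sub, Polynomial.map_one]
    rw [eq_intCast f d, C_neg]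
    ring
  have hPi0 : ∀ i, (P i).map f ≠ 0 := fun i => (Polynomial.map_ne_zero_iff hinj).mpr (hP0 i)
  set Rhs : ℚ[X] := C (-(d : ℚ)) * X * (X - 1) * ∏ i, (P i).map f with hRhs
  have hRhs0 : Rhs ≠ 0 := by
    refine mul_ne_zero (mul_ne_zero (mul_ne_zero (C_ne_zero.mpr ?_) X_ne_zero) hX1)
      (Finset.prod_ne_zero_iff.mpr fun i _ => hPi0 i)
    exact neg_ne_zero.mpr (by exact_mod_cast hd0)
  have hdvd : radical (A * B * -Cq) ∣ Rhs := by
    rw [hprod, hRhs]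
    refine radical_mul_dvd.trans (mul_dvd_mul ?_ ?_)
    · refine radical_mul_dvd.trans (mul_dvd_mul ?_ ?_)
      · refine radical_mul_dvd.trans (mul_dvd_mul radical_dvd_self ?_)
        exact (radical_pow_dvd_radical' _ _).trans radical_dvd_self
      · exact (radical_pow_dvd_radical' _ _).trans radical_dvd_self
    · exact (radical_prod_dvd' _ _).trans (Finset.prod_dvd_prod_of_dvd _ _ fun i _ =>
        (radical_pow_dvd_radical' _ _).trans radical_dvd_self)
  have hdegR : Rhs.natDegree = 2 + ∑ i, (P i).natDegree := by
    rw [hRhs, natDegree_mul (mul_ne_zero (mul_ne_zero (C_ne_zero.mpr (neg_ne_zero.mpr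
        (by exact_mod_cast hd0))) X_ne_zero) hX1) (Finset.prod_ne_zero_iff.mpr fun i _ => hPi0 i),
      natDegree_mul (mul_ne_zero (C_ne_zero.mpr (neg_ne_zero.mpr (by exact_mod_cast hd0))) X_ne_zero)
        hX1, natDegree_mul (C_ne_zero.mpr (neg_ne_zero.mpr (by exact_mod_cast hd0))) X_ne_zero,
      natDegree_C, natDegree_X, hX1deg, natDegree_prod _ _ (fun i _ => hPi0 i)]
    simp only [natDegree_map_eq_of_injective hinj]
  have hle : (radical (A * B * -Cq)).natDegree ≤ 2 + ∑ i, (P i).natDegree := by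
    rw [← hdegR]; exact natDegree_le_of_dvd hdvd hRhs0
  have hif : (if (A * B * -Cq).natDegree < 3 * n then 1 else 0) ≤ 1 := by split_ifs <;> omega
  omega

end Summit.ABC.ABC.Theorems

end
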